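/-
Copyright: harness tree, Literature layer (sorry-free). b2b-lace CARVER gen 44 (what-if / input-certification
support; number-free).  SHARP ALTERNATING-SERIES BOUNDS FOR `J_n(x)`, `x² ≤ 4(n+1)`.
-/
import Literature.Analysis.FunctionSpaces.BesselJAnalyticProofs
import Mathlib.Analysis.SpecialFunctions.Exponential
import Mathlib.Analysis.SpecificLimits.Normed
import HarnessLib

/-!
# Sharp alternating-series bounds for the Bessel function `J_n`

For real `x` with `x² ≤ 4(n+1)` the absolute values of the terms of the ascending series
`J_n(x) = Σ_k (-1)^k (x/2)^{2k+n}/(k!(k+n)!)` (`besselJ`, `besselJTerm`) are NON-INCREASING in `k`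
(ratio `(x/2)²/((k+1)(k+n+1)) ≤ 1`), so the series is a Leibniz alternating series and

* `|J_n(x) − Σ_{k<N} besselJTerm n x k| ≤ |besselJTerm n x N|` for EVERY `N`
  (`abs_besselJ_sub_sum_range_le_abs_besselJTerm_of_sq_le`) — the sharp "first omitted term"
  remainder, WITHOUT the factor `e^{|x/2|²}` of the majorant-series remainder;
* `N = 0`: the classical sharp bound `|J_n(x)| ≤ |x/2|^n / n!` (`abs_besselJ_le_pow_div_factorial_of_sq_le`;
  DLMF 10.14.4 states it for all real `x` via Poisson's integral — here the elementary Leibniz proof in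
  the regime `x² ≤ 4(n+1)`, which contains every order `n ≥ 2` for `|x| ≤ 2√3`);
* the ORDER TAIL `Σ_{l ≥ 0} |J_{l+J+1}(y)| ≤ |y/2|^{J+1}/(J+1)! · e^{|y/2|}` for `y² ≤ 4(J+2)`
  (`tsum_abs_besselJ_orderTail_le_of_sq_le`), against `… · e^{|y/2|²+|y/2|}` from the majorant series.

All statements number-free; no dimension; standard axioms only.  USE (what-if lane, informational):
rational enclosures of `J_j(β/d)` at the twisted-row arguments and a tighter closed ORDER BALL for the
truncated Bessel rows of the twisted seeds (KU-SEP); nothing here is a certificate.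

## References
* NIST DLMF §10.2.2 (series), §10.14.4 (`|J_n(x)| ≤ |x/2|^n/n!`). [DLMF]
* G. N. Watson, *A Treatise on the Theory of Bessel Functions* (1944), §2.1 (8), §2.11, §3.31. [Watson1944]
-/

noncomputable section

open Finset Filter
open scoped Nat Topology

namespace Literature.Analysis.FunctionSpaces

/-! ### The absolute terms and their monotonicity -/

/-- `besselJTerm n x k = (-1)^k · a_k(x)` with `a_k(x) = (x/2)^{2k+n}/(k!(k+n)!)`. [folklore] -/
private theorem besselJTerm_eq_neg_one_pow_mul (n : ℕ) (x : ℝ) (k : ℕ) :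
    besselJTerm n x k = (-1) ^ k * ((x / 2) ^ (2 * k + n) / ((k ! : ℝ) * ((k + n)! : ℝ))) := by
  unfold besselJTerm
  ring

/-- For `0 ≤ x`, `|besselJTerm n x k| = a_k(x)`. [folklore] -/
private theorem abs_besselJTerm_of_nonneg (n : ℕ) {x : ℝ} (hx : 0 ≤ x) (k : ℕ) :
    |besselJTerm n x k| = (x / 2) ^ (2 * k + n) / ((k ! : ℝ) * ((k + n)! : ℝ)) := by
  rw [besselJTerm_eq_neg_one_pow_mul, abs_mul, abs_pow, abs_neg, abs_one, one_pow, one_mul,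
    abs_of_nonneg (by positivity)]

/-- Leibniz hypothesis: for `0 ≤ x`, `x² ≤ 4(n+1)` the absolute terms are non-increasing.
[cite: Watson1944, §2.11] -/
theorem antitone_besselJ_absTerm (n : ℕ) {x : ℝ} (hx : 0 ≤ x) (h : x ^ 2 ≤ 4 * (n + 1)) :
    Antitone fun k : ℕ => (x / 2) ^ (2 * k + n) / ((k ! : ℝ) * ((k + n)! : ℝ)) := by
  refine antitone_nat_of_succ_le fun k => ?_
  have hk0 : (0:ℝ) < (k ! : ℝ) * ((k + n)! : ℝ) := by positivity
  have hk1 : (0:ℝ) < ((k + 1)! : ℝ) * ((k + 1 + n)! : ℝ) := by positivity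
  rw [div_le_div_iff₀ hk1 hk0]
  have e1 : (x / 2) ^ (2 * (k + 1) + n) = (x / 2) ^ (2 * k + n) * (x / 2) ^ 2 := by
    rw [← pow_add]; congr 1; ring
  have e2 : ((k + 1)! : ℝ) * ((k + 1 + n)! : ℝ)
      = ((k ! : ℝ) * ((k + n)! : ℝ)) * ((k + 1 : ℝ) * (k + n + 1 : ℝ)) := by
    rw [Nat.factorial_succ, show k + 1 + n = (k + n) + 1 by ring, Nat.factorial_succ]
    push_cast
    ring
  have hx2 : (x / 2) ^ 2 ≤ (k + 1 : ℝ) * (k + n + 1 : ℝ) := by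
    have h1 : (x / 2) ^ 2 ≤ (n + 1 : ℝ) := by nlinarith
    have h2 : (n + 1 : ℝ) ≤ (k + 1 : ℝ) * (k + n + 1 : ℝ) := by
      have : (0:ℝ) ≤ k := Nat.cast_nonneg k
      nlinarith
    exact h1.trans h2
  have hp : 0 ≤ (x / 2) ^ (2 * k + n) := by positivity
  rw [e1, e2]
  calc (x / 2) ^ (2 * k + n) * (x / 2) ^ 2 * ((k ! : ℝ) * ((k + n)! : ℝ))
      = (x / 2) ^ (2 * k + n) * ((k ! : ℝ) * ((k + n)! : ℝ)) * (x / 2) ^ 2 := by ring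
    _ ≤ (x / 2) ^ (2 * k + n) * ((k ! : ℝ) * ((k + n)! : ℝ)) * ((k + 1 : ℝ) * (k + n + 1 : ℝ)) := by
        gcongr
    _ = (x / 2) ^ (2 * k + n) * ((k ! : ℝ) * ((k + n)! : ℝ) * ((k + 1 : ℝ) * (k + n + 1 : ℝ))) := by
        ring

/-! ### Leibniz brackets for `0 ≤ x` -/

/-- Partial sums of the Bessel series converge to `J_n(x)`, written in the alternating shape
`Σ_{i<N} (-1)^i a_i(x)`. [folklore] -/
private theorem tendsto_sum_range_besselJ_alt (n : ℕ) (x : ℝ) :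
    Tendsto (fun N => ∑ i ∈ Finset.range N,
        (-1) ^ i * ((x / 2) ^ (2 * i + n) / ((i ! : ℝ) * ((i + n)! : ℝ)))) atTop (𝓝 (besselJ n x)) := by
  have h := (hasSum_besselJ_holds n x).tendsto_sum_nat
  refine h.congr fun N => Finset.sum_congr rfl fun i _ => besselJTerm_eq_neg_one_pow_mul n x i

/-- Leibniz brackets: for `0 ≤ x`, `x² ≤ 4(n+1)` and every `k`,
`Σ_{i<2k} besselJTerm n x i ≤ J_n(x) ≤ Σ_{i<2k+1} besselJTerm n x i`. [cite: Watson1944, §2.11] -/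
theorem sum_range_even_le_besselJ_and_le_odd (n : ℕ) {x : ℝ} (hx : 0 ≤ x) (h : x ^ 2 ≤ 4 * (n + 1))
    (k : ℕ) :
    ∑ i ∈ Finset.range (2 * k), besselJTerm n x i ≤ besselJ n x
      ∧ besselJ n x ≤ ∑ i ∈ Finset.range (2 * k + 1), besselJTerm n x i := by
  have hfl := tendsto_sum_range_besselJ_alt n x
  have hfa := antitone_besselJ_absTerm n hx h
  constructor
  · have := hfa.alternating_series_le_tendsto hfl k
    simpa only [besselJTerm_eq_neg_one_pow_mul] using this
  · have := hfa.tendsto_le_alternating_series hfl k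
    simpa only [besselJTerm_eq_neg_one_pow_mul] using this

/-- Sharp remainder for `0 ≤ x`. [cite: Watson1944, §2.11] -/
private theorem abs_besselJ_sub_sum_range_le_of_nonneg (n : ℕ) {x : ℝ} (hx : 0 ≤ x)
    (h : x ^ 2 ≤ 4 * (n + 1)) (N : ℕ) :
    |besselJ n x - ∑ k ∈ Finset.range N, besselJTerm n x k| ≤ |besselJTerm n x N| := by
  rcases Nat.even_or_odd N with ⟨k, hk⟩ | ⟨k, hk⟩
  · -- N = 2k: S_{2k} ≤ J ≤ S_{2k+1} = S_{2k} + term_{2k}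
    have h1 := (sum_range_even_le_besselJ_and_le_odd n hx h k).1
    have h2 := (sum_range_even_le_besselJ_and_le_odd n hx h k).2
    rw [show k + k = 2 * k by ring] at hk
    subst hk
    rw [Finset.sum_range_succ] at h2
    rw [abs_le]
    constructor
    · have : 0 ≤ |besselJTerm n x (2 * k)| := abs_nonneg _
      linarith
    · linarith [le_abs_self (besselJTerm n x (2 * k))]
  · -- N = 2k+1: S_{2k+2} = S_{2k+1} + term_{2k+1} ≤ J ≤ S_{2k+1}
    have h1 := (sum_range_even_le_besselJ_and_le_odd n hx h (k + 1)).1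
    have h2 := (sum_range_even_le_besselJ_and_le_odd n hx h k).2
    subst hk
    rw [show 2 * (k + 1) = 2 * k + 1 + 1 by ring, Finset.sum_range_succ] at h1
    rw [abs_le]
    constructor
    · linarith [neg_abs_le (besselJTerm n x (2 * k + 1))]
    · have : 0 ≤ |besselJTerm n x (2 * k + 1)| := abs_nonneg _
      linarith

/-! ### Parity and the bounds for all real `x` -/

/-- **Sharp series remainder.** For real `x` with `x² ≤ 4(n+1)` and every `N`,
`|J_n(x) − Σ_{k<N} besselJTerm n x k| ≤ |besselJTerm n x N| = |x/2|^{2N+n}/(N!(N+n)!)`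
(Leibniz; no exponential factor). [cite: DLMF, 10.2.2; Watson1944, §2.11] -/
theorem abs_besselJ_sub_sum_range_le_abs_besselJTerm_of_sq_le (n : ℕ) {x : ℝ}
    (h : x ^ 2 ≤ 4 * (n + 1)) (N : ℕ) :
    |besselJ n x - ∑ k ∈ Finset.range N, besselJTerm n x k| ≤ |besselJTerm n x N| := by
  rcases le_total 0 x with hx | hx
  · exact abs_besselJ_sub_sum_range_le_of_nonneg n hx h N
  · -- reduce to `-x ≥ 0` by parity
    have hx' : 0 ≤ -x := by linarith
    have h' : (-x) ^ 2 ≤ 4 * (n + 1) := by rwa [neg_sq]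
    have key := abs_besselJ_sub_sum_range_le_of_nonneg n hx' h' N
    rw [besselJ_neg, besselJTerm_neg] at key
    simp_rw [besselJTerm_neg] at key
    rw [← Finset.mul_sum, ← mul_sub, abs_mul, abs_mul, abs_pow, abs_neg, abs_one, one_pow,
      one_mul, one_mul] at key
    exact key

/-- The absolute value of the `N`-th term in closed form `|x/2|^{2N+n}/(N!(N+n)!)`.
[cite: DLMF, 10.2.2] -/
theorem abs_besselJTerm_eq (n : ℕ) (x : ℝ) (N : ℕ) :
    |besselJTerm n x N| = |x / 2| ^ (2 * N + n) / ((N ! : ℝ) * ((N + n)! : ℝ)) := by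
  rw [besselJTerm_eq_neg_one_pow_mul, abs_mul, abs_pow, abs_neg, abs_one, one_pow, one_mul, abs_div,
    abs_pow, abs_of_pos (by positivity : (0:ℝ) < (N ! : ℝ) * ((N + n)! : ℝ))]

/-- **Two-sided rational enclosure** for `x² ≤ 4(n+1)`:
`J_n(x) ∈ [S_N − |t_N|, S_N + |t_N|]`, `S_N = Σ_{k<N} besselJTerm n x k`, `t_N = besselJTerm n x N`.
[cite: DLMF, 10.2.2; Watson1944, §2.11] -/
theorem besselJ_mem_Icc_sum_range_of_sq_le (n : ℕ) {x : ℝ} (h : x ^ 2 ≤ 4 * (n + 1)) (N : ℕ) :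
    besselJ n x ∈ Set.Icc
      (∑ k ∈ Finset.range N, besselJTerm n x k - |besselJTerm n x N|)
      (∑ k ∈ Finset.range N, besselJTerm n x k + |besselJTerm n x N|) := by
  have hb := abs_besselJ_sub_sum_range_le_abs_besselJTerm_of_sq_le n h N
  rw [abs_le] at hb
  rw [Set.mem_Icc]
  constructor <;> linarith [hb.1, hb.2]

/-- **`|J_n(x)| ≤ |x/2|^n / n!` for `x² ≤ 4(n+1)`** (the sharp classical bound, DLMF 10.14.4, in the
Leibniz regime). [cite: DLMF, 10.14.4; Watson1944, §3.31] -/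
theorem abs_besselJ_le_pow_div_factorial_of_sq_le (n : ℕ) {x : ℝ} (h : x ^ 2 ≤ 4 * (n + 1)) :
    |besselJ n x| ≤ |x / 2| ^ n / (n ! : ℝ) := by
  have hb := abs_besselJ_sub_sum_range_le_abs_besselJTerm_of_sq_le n h 0
  rw [Finset.sum_range_zero, sub_zero, abs_besselJTerm_eq] at hb
  simpa using hb

/-! ### The order tail -/

/-- Termwise: for `y² ≤ 4(J+2)`, `|J_{l+J+1}(y)| ≤ |y/2|^{J+1}/(J+1)! · |y/2|^l/l!`.
[cite: DLMF, 10.14.4] -/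
theorem abs_besselJ_orderTail_term_le_of_sq_le (J : ℕ) {y : ℝ} (h : y ^ 2 ≤ 4 * (J + 2)) (l : ℕ) :
    |besselJ (l + J + 1) y| ≤ |y / 2| ^ (J + 1) / ((J + 1)! : ℝ) * (|y / 2| ^ l / (l ! : ℝ)) := by
  have hl : y ^ 2 ≤ 4 * ((l + J + 1 : ℕ) + 1 : ℝ) := by
    push_cast
    have : (0:ℝ) ≤ l := Nat.cast_nonneg l
    linarith
  have hb := abs_besselJ_le_pow_div_factorial_of_sq_le (l + J + 1) hl
  have hs : 0 ≤ |y / 2| := abs_nonneg _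
  have hfac : ((J + 1)! : ℝ) * (l ! : ℝ) ≤ ((l + J + 1)! : ℝ) := by
    have := Nat.le_of_dvd (Nat.factorial_pos _) (Nat.factorial_mul_factorial_dvd_factorial_add (J + 1) l)
    rw [show J + 1 + l = l + J + 1 by ring] at this
    exact_mod_cast this
  have hJpos : (0:ℝ) < (J + 1)! := by positivity
  have hlpos : (0:ℝ) < l ! := by positivity
  calc |besselJ (l + J + 1) y| ≤ |y / 2| ^ (l + J + 1) / ((l + J + 1)! : ℝ) := hb
    _ ≤ |y / 2| ^ (l + J + 1) / (((J + 1)! : ℝ) * (l ! : ℝ)) := by gcongr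
    _ = |y / 2| ^ (J + 1) / ((J + 1)! : ℝ) * (|y / 2| ^ l / (l ! : ℝ)) := by
        rw [show l + J + 1 = (J + 1) + l by ring, pow_add]
        field_simp

/-- Summability of the order tail `Σ_l |J_{l+J+1}(y)|` (`y² ≤ 4(J+2)`). [cite: DLMF, 10.14.4] -/
theorem summable_abs_besselJ_orderTail_of_sq_le (J : ℕ) {y : ℝ} (h : y ^ 2 ≤ 4 * (J + 2)) :
    Summable fun l : ℕ => |besselJ (l + J + 1) y| := by
  have hexp : HasSum (fun l : ℕ => |y / 2| ^ l / l !) (Real.exp |y / 2|) := by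
    rw [Real.exp_eq_exp_ℝ]
    exact NormedSpace.expSeries_div_hasSum_exp (|y / 2| : ℝ)
  refine Summable.of_nonneg_of_le (fun l => abs_nonneg _)
    (fun l => abs_besselJ_orderTail_term_le_of_sq_le J h l) ?_
  exact (hexp.mul_left _).summable

/-- **Order tail, sharp closed form:** for `y² ≤ 4(J+2)`,
`Σ_{l ≥ 0} |J_{l+J+1}(y)| ≤ |y/2|^{J+1}/(J+1)! · e^{|y/2|}`. [cite: DLMF, 10.14.4; Watson1944, §3.31] -/
theorem tsum_abs_besselJ_orderTail_le_of_sq_le (J : ℕ) {y : ℝ} (h : y ^ 2 ≤ 4 * (J + 2)) :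
    ∑' l : ℕ, |besselJ (l + J + 1) y| ≤ |y / 2| ^ (J + 1) / ((J + 1)! : ℝ) * Real.exp |y / 2| := by
  have hexp : HasSum (fun l : ℕ => |y / 2| ^ l / l !) (Real.exp |y / 2|) := by
    rw [Real.exp_eq_exp_ℝ]
    exact NormedSpace.expSeries_div_hasSum_exp (|y / 2| : ℝ)
  have hmaj := hexp.mul_left (|y / 2| ^ (J + 1) / ((J + 1)! : ℝ))
  calc ∑' l : ℕ, |besselJ (l + J + 1) y|
      ≤ ∑' l : ℕ, |y / 2| ^ (J + 1) / ((J + 1)! : ℝ) * (|y / 2| ^ l / l !) :=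
        (summable_abs_besselJ_orderTail_of_sq_le J h).tsum_le_tsum
          (fun l => abs_besselJ_orderTail_term_le_of_sq_le J h l) hmaj.summable
    _ = |y / 2| ^ (J + 1) / ((J + 1)! : ℝ) * Real.exp |y / 2| := hmaj.tsum_eq

/-- Finite-plus-tail split of the order tail (enclose the first `K` tail orders individually, bound
only the rest in closed form): `Σ_{l≥0}|J_{l+J+1}(y)| = Σ_{l<K}|J_{l+J+1}(y)| + Σ_{l≥0}|J_{l+(J+K)+1}(y)|`
for any summable order tail. [cite: DLMF, 10.14.4] -/
theorem tsum_abs_besselJ_orderTail_eq_sum_add_tsum (J K : ℕ) {y : ℝ}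
    (hs : Summable fun l : ℕ => |besselJ (l + J + 1) y|) :
    ∑' l : ℕ, |besselJ (l + J + 1) y|
      = ∑ l ∈ Finset.range K, |besselJ (l + J + 1) y| + ∑' l : ℕ, |besselJ (l + (J + K) + 1) y| := by
  rw [← Summable.sum_add_tsum_nat_add K hs]
  congr 1
  refine tsum_congr fun l => ?_
  rw [show l + K + J + 1 = l + (J + K) + 1 by ring]

end Literature.Analysis.FunctionSpaces

end
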